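import Summits.HubbardSuperconductivity.HubbardSuperconductivity.Theorems.MesoscopicPairOrder.Negative.StonerQuarticBand
import HarnessLib

/-!
# Crux `MesoscopicPairOrder` (stmt-HubbardSuperconductivity-7331), Negative side:
# band moments up to degree 8 and the Stoner spin ceiling with OCTIC hinge majorants

Line `redirect_birth` (lead c11), Negative programme E1 (no nearly saturated ferromagnetism on the (Q)/(D) box),
companion of `StonerQuarticBand.lean`. The quartic hinge majorants (`Σ_k ε_L(k)⁴ = 36 L²`) certify the Stoner
exclusion up to `U ≤ 11/2`; reaching the box edge `U = 6` needs the polarised-band hinge `Σ_k (μ - ε_L(k))₊`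
within `≈ 0.03 t` per site, i.e. DEGREE-8 polynomial majorants, i.e. the band moments up to `8`
(`E[ε^{2j}] = C(2j,j)²`: `1, 4, 36, 400, 4900`; odd moments vanish). Here, with `ε = -2(c₀ + c₁)`,
`cᵢ = cos pᵢ(k)`:

* `cos_four_mul_eq`, …, `cos_eight_mul_eq` — the Chebyshev expansions `cos(jx) = T_j(cos x)`, `j = 4, …, 8`;
* `sum_cos_pow_five_latticeMomentum` (`= 0`, `L ≥ 6`), `sum_cos_pow_six_latticeMomentum` (`= 5L²/16`, `L ≥ 7`),
  `sum_cos_pow_seven_latticeMomentum` (`= 0`, `L ≥ 8`), `sum_cos_pow_eight_latticeMomentum` (`= 35L²/128`, `L ≥ 9`),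
  each from the power-reduction formula and `Σ_k cos(j pᵢ(k)) = 0` (`0 < j < L`); the one-coordinate sums
  `sum_cos_pow_four_val` (`= 3L/8`), `sum_cos_pow_five_val` (`= 0`), `sum_cos_pow_six_val` (`= 5L/16`),
  `sum_cos_pow_seven_val` (`= 0`) for the mixed monomials;
* the band moments `sum_torusBand_pow_five` (`= 0`), **`sum_torusBand_pow_six` (`Σ_k ε_L(k)⁶ = 400 L²`)**,
  `sum_torusBand_pow_seven` (`= 0`), **`sum_torusBand_pow_eight` (`Σ_k ε_L(k)⁸ = 4900 L²`)**
  (equivalently `tr T⁶ = 400 L²`, `tr T⁸ = 4900 L²`: closed `6`- and `8`-step walks on `ℤ²`);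
* `sum_posPart_le_of_octic` — any octic majorant `P ≥ (μ - ·)₊` on `[-4, 4]` gives
  `Σ_k (μ - ε_L(k))₊ ≤ L²(p₀ + 4p₂ + 36p₄ + 400p₆ + 4900p₈)` (`L ≥ 9`);
* `octic_spin_le_of_pairedSea_exact` — the Stoner criterion `hinge_spin_le_of_pairedSea_exact` with this hinge
  bound: **`2μn - L²(p₀ + 4p₂ + 36p₄ + 400p₆ + 4900p₈) - 2Σ_{k∈l} ε_L(k) - U n²/L² ≤ (μ + 4)(n - S)`**;
* `sumTorusBandPowEight` — the registered sub-goal form of the eighth moment.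
The evaluation on the box (degree-8 majorants, trial seas) is a companion file.
Sources: E. C. Stoner, Proc. R. Soc. A 165 (1938) 372; E. H. Lieb, M. Loss, *Analysis* (2001) Thm 1.14;
H. Tasaki, Prog. Theor. Phys. 99 (1998) 489, §5. Folklore finite-dimensional statements; no definition,
no named fact, no sorry.
-/

noncomputable section

-- the summit namespace repeats the problem name by design (D-0017)
set_option linter.dupNamespace false

namespace Summit.HubbardSuperconductivity.HubbardSuperconductivity.Theorems.MesoscopicPairOrder.Negative

open Matrix Finset Filter
open Literature.Probability.LatticeModels Literature.MathematicalPhysics.QuantumLattice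
open scoped ComplexOrder ComplexConjugate

/-! ### Chebyshev expansions `cos(jx) = T_j(cos x)`, `j = 4, …, 8` -/

/-- `cos 4x = 8c⁴ - 8c² + 1` (`c = cos x`; `T₄ = 2T₂² - 1`). [folklore] -/
theorem cos_four_mul_eq (x : ℝ) : Real.cos (4 * x) = 8 * Real.cos x ^ 4 - 8 * Real.cos x ^ 2 + 1 := by
  rw [show (4 : ℝ) * x = 2 * (2 * x) by ring, Real.cos_two_mul, Real.cos_two_mul]
  ring

/-- `cos 5x = 16c⁵ - 20c³ + 5c` (`T₅`, from `2 cos 3x cos 2x = cos x + cos 5x`). [folklore] -/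
theorem cos_five_mul_eq (x : ℝ) :
    Real.cos (5 * x) = 16 * Real.cos x ^ 5 - 20 * Real.cos x ^ 3 + 5 * Real.cos x := by
  have h : Real.cos (5 * x) = 2 * Real.cos (3 * x) * Real.cos (2 * x) - Real.cos x := by
    rw [Real.two_mul_cos_mul_cos, show (3 : ℝ) * x - 2 * x = x by ring,
      show (3 : ℝ) * x + 2 * x = 5 * x by ring]
    ring
  rw [h, Real.cos_three_mul, Real.cos_two_mul]
  ring

/-- `cos 6x = 32c⁶ - 48c⁴ + 18c² - 1` (`T₆ = 2T₃² - 1`). [folklore] -/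
theorem cos_six_mul_eq (x : ℝ) :
    Real.cos (6 * x) = 32 * Real.cos x ^ 6 - 48 * Real.cos x ^ 4 + 18 * Real.cos x ^ 2 - 1 := by
  rw [show (6 : ℝ) * x = 2 * (3 * x) by ring, Real.cos_two_mul, Real.cos_three_mul]
  ring

/-- `cos 7x = 64c⁷ - 112c⁵ + 56c³ - 7c` (`T₇`, from `2 cos 4x cos 3x = cos x + cos 7x`). [folklore] -/
theorem cos_seven_mul_eq (x : ℝ) :
    Real.cos (7 * x) = 64 * Real.cos x ^ 7 - 112 * Real.cos x ^ 5 + 56 * Real.cos x ^ 3 - 7 * Real.cos x := by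
  have h : Real.cos (7 * x) = 2 * Real.cos (4 * x) * Real.cos (3 * x) - Real.cos x := by
    rw [Real.two_mul_cos_mul_cos, show (4 : ℝ) * x - 3 * x = x by ring,
      show (4 : ℝ) * x + 3 * x = 7 * x by ring]
    ring
  rw [h, cos_four_mul_eq, Real.cos_three_mul]
  ring

/-- `cos 8x = 128c⁸ - 256c⁶ + 160c⁴ - 32c² + 1` (`T₈ = 2T₄² - 1`). [folklore] -/
theorem cos_eight_mul_eq (x : ℝ) :
    Real.cos (8 * x) =
      128 * Real.cos x ^ 8 - 256 * Real.cos x ^ 6 + 160 * Real.cos x ^ 4 - 32 * Real.cos x ^ 2 + 1 := by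
  rw [show (8 : ℝ) * x = 2 * (4 * x) by ring, Real.cos_two_mul, cos_four_mul_eq]
  ring

section Octic

variable {L : ℕ} [NeZero L]

/-! ### Cosine power sums of degree 5 to 8 over the momentum grid -/

/-- **`Σ_k cos⁵(p_i(k)) = 0`** (`L ≥ 6`): `cos⁵ = (10 cos + 5 cos(3·) + cos(5·))/16`. [folklore] -/
theorem sum_cos_pow_five_latticeMomentum (hL : 6 ≤ L) (i : Fin 2) :
    ∑ k : TorusSite 2 L, Real.cos (latticeMomentum L k i) ^ 5 = 0 := by
  have e : ∀ k : TorusSite 2 L, Real.cos (latticeMomentum L k i) ^ 5 =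
      (10 * Real.cos (latticeMomentum L k i) + 5 * Real.cos (3 * latticeMomentum L k i) +
        Real.cos (5 * latticeMomentum L k i)) / 16 := fun k => by
    rw [Real.cos_three_mul, cos_five_mul_eq]; ring
  simp_rw [e]
  rw [← Finset.sum_div, Finset.sum_add_distrib, Finset.sum_add_distrib, ← Finset.mul_sum, ← Finset.mul_sum]
  have h1 := sum_cos_natMul_latticeMomentum_eq_zero (L := L) (j := 1) (by norm_num) (by omega) i
  have h3 := sum_cos_natMul_latticeMomentum_eq_zero (L := L) (j := 3) (by norm_num) (by omega) i
  have h5 := sum_cos_natMul_latticeMomentum_eq_zero (L := L) (j := 5) (by norm_num) (by omega) i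
  simp only [Nat.cast_one, one_mul] at h1
  simp only [Nat.cast_ofNat] at h3 h5
  rw [h1, h3, h5]
  norm_num

/-- **`Σ_k cos⁶(p_i(k)) = 5L²/16`** (`L ≥ 7`): `cos⁶ = (10 + 15 cos(2·) + 6 cos(4·) + cos(6·))/32`. [folklore] -/
theorem sum_cos_pow_six_latticeMomentum (hL : 7 ≤ L) (i : Fin 2) :
    ∑ k : TorusSite 2 L, Real.cos (latticeMomentum L k i) ^ 6 = 5 * (L : ℝ) ^ 2 / 16 := by
  have e : ∀ k : TorusSite 2 L, Real.cos (latticeMomentum L k i) ^ 6 =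
      5 / 16 + (15 / 32) * Real.cos (2 * latticeMomentum L k i) + (3 / 16) * Real.cos (4 * latticeMomentum L k i) +
        (1 / 32) * Real.cos (6 * latticeMomentum L k i) := fun k => by
    rw [Real.cos_two_mul, cos_four_mul_eq, cos_six_mul_eq]; ring
  simp_rw [e]
  rw [Finset.sum_add_distrib, Finset.sum_add_distrib, Finset.sum_add_distrib, ← Finset.mul_sum, ← Finset.mul_sum,
    ← Finset.mul_sum]
  have h2 := sum_cos_natMul_latticeMomentum_eq_zero (L := L) (j := 2) (by norm_num) (by omega) i
  have h4 := sum_cos_natMul_latticeMomentum_eq_zero (L := L) (j := 4) (by norm_num) (by omega) i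
  have h6 := sum_cos_natMul_latticeMomentum_eq_zero (L := L) (j := 6) (by norm_num) (by omega) i
  simp only [Nat.cast_ofNat] at h2 h4 h6
  have hcard : Fintype.card (TorusSite 2 L) = L ^ 2 := by simp [Fintype.card_pi, ZMod.card]
  rw [h2, h4, h6, Finset.sum_const, Finset.card_univ, hcard]
  simp only [nsmul_eq_mul]
  push_cast
  ring

/-- **`Σ_k cos⁷(p_i(k)) = 0`** (`L ≥ 8`): `cos⁷ = (35 cos + 21 cos(3·) + 7 cos(5·) + cos(7·))/64`. [folklore] -/
theorem sum_cos_pow_seven_latticeMomentum (hL : 8 ≤ L) (i : Fin 2) :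
    ∑ k : TorusSite 2 L, Real.cos (latticeMomentum L k i) ^ 7 = 0 := by
  have e : ∀ k : TorusSite 2 L, Real.cos (latticeMomentum L k i) ^ 7 =
      (35 * Real.cos (latticeMomentum L k i) + 21 * Real.cos (3 * latticeMomentum L k i) +
        7 * Real.cos (5 * latticeMomentum L k i) + Real.cos (7 * latticeMomentum L k i)) / 64 := fun k => by
    rw [Real.cos_three_mul, cos_five_mul_eq, cos_seven_mul_eq]; ring
  simp_rw [e]
  rw [← Finset.sum_div, Finset.sum_add_distrib, Finset.sum_add_distrib, Finset.sum_add_distrib, ← Finset.mul_sum,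
    ← Finset.mul_sum, ← Finset.mul_sum]
  have h1 := sum_cos_natMul_latticeMomentum_eq_zero (L := L) (j := 1) (by norm_num) (by omega) i
  have h3 := sum_cos_natMul_latticeMomentum_eq_zero (L := L) (j := 3) (by norm_num) (by omega) i
  have h5 := sum_cos_natMul_latticeMomentum_eq_zero (L := L) (j := 5) (by norm_num) (by omega) i
  have h7 := sum_cos_natMul_latticeMomentum_eq_zero (L := L) (j := 7) (by norm_num) (by omega) i
  simp only [Nat.cast_one, one_mul] at h1
  simp only [Nat.cast_ofNat] at h3 h5 h7
  rw [h1, h3, h5, h7]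
  norm_num

/-- **`Σ_k cos⁸(p_i(k)) = 35L²/128`** (`L ≥ 9`): `cos⁸ = (35 + 56 cos(2·) + 28 cos(4·) + 8 cos(6·) + cos(8·))/128`.
[folklore] -/
theorem sum_cos_pow_eight_latticeMomentum (hL : 9 ≤ L) (i : Fin 2) :
    ∑ k : TorusSite 2 L, Real.cos (latticeMomentum L k i) ^ 8 = 35 * (L : ℝ) ^ 2 / 128 := by
  have e : ∀ k : TorusSite 2 L, Real.cos (latticeMomentum L k i) ^ 8 =
      35 / 128 + (7 / 16) * Real.cos (2 * latticeMomentum L k i) + (7 / 32) * Real.cos (4 * latticeMomentum L k i) +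
        (1 / 16) * Real.cos (6 * latticeMomentum L k i) + (1 / 128) * Real.cos (8 * latticeMomentum L k i) := fun k => by
    rw [Real.cos_two_mul, cos_four_mul_eq, cos_six_mul_eq, cos_eight_mul_eq]; ring
  simp_rw [e]
  rw [Finset.sum_add_distrib, Finset.sum_add_distrib, Finset.sum_add_distrib, Finset.sum_add_distrib,
    ← Finset.mul_sum, ← Finset.mul_sum, ← Finset.mul_sum, ← Finset.mul_sum]
  have h2 := sum_cos_natMul_latticeMomentum_eq_zero (L := L) (j := 2) (by norm_num) (by omega) i
  have h4 := sum_cos_natMul_latticeMomentum_eq_zero (L := L) (j := 4) (by norm_num) (by omega) i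
  have h6 := sum_cos_natMul_latticeMomentum_eq_zero (L := L) (j := 6) (by norm_num) (by omega) i
  have h8 := sum_cos_natMul_latticeMomentum_eq_zero (L := L) (j := 8) (by norm_num) (by omega) i
  simp only [Nat.cast_ofNat] at h2 h4 h6 h8
  have hcard : Fintype.card (TorusSite 2 L) = L ^ 2 := by simp [Fintype.card_pi, ZMod.card]
  rw [h2, h4, h6, h8, Finset.sum_const, Finset.card_univ, hcard]
  simp only [nsmul_eq_mul]
  push_cast
  ring

/-! ### One-coordinate cosine power sums -/

/-- One-coordinate reduction: a grid sum of a function of `p₀(k)` alone is `L` times the sum over `ℤ/Lℤ`, so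
`Σ_k f(p₀(k)) = L c` gives `Σ_{v ∈ ℤ/Lℤ} f(2πv/L) = c`. [folklore] -/
theorem sum_val_eq_of_sum_latticeMomentum (f : ℝ → ℝ) {c : ℝ}
    (h : ∑ k : TorusSite 2 L, f (latticeMomentum L k 0) = (L : ℝ) * c) :
    ∑ v : ZMod L, f (2 * Real.pi * ((v.val : ℝ)) / L) = c := by
  have h2 : ∑ k : TorusSite 2 L, f (latticeMomentum L k 0) =
      ∑ a : ZMod L, ∑ _b : ZMod L, f (2 * Real.pi * ((a.val : ℝ)) / L) := by
    simp_rw [latticeMomentum_apply]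
    exact sum_torusSite_two (fun a _ => f (2 * Real.pi * ((a.val : ℝ)) / L))
  rw [h2] at h
  simp only [Finset.sum_const, Finset.card_univ, ZMod.card, nsmul_eq_mul] at h
  rw [← Finset.mul_sum] at h
  have hL0 : (L : ℝ) ≠ 0 := by exact_mod_cast NeZero.ne L
  exact mul_left_cancel₀ hL0 h

/-- `Σ_{v ∈ ℤ/Lℤ} cos⁴(2πv/L) = 3L/8` (`L ≥ 5`; one-coordinate form of `sum_cos_pow_four_latticeMomentum`).
[folklore] -/
theorem sum_cos_pow_four_val (hL : 5 ≤ L) :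
    ∑ v : ZMod L, Real.cos (2 * Real.pi * ((v.val : ℝ)) / L) ^ 4 = 3 * (L : ℝ) / 8 := by
  refine sum_val_eq_of_sum_latticeMomentum (fun x => Real.cos x ^ 4) ?_
  rw [sum_cos_pow_four_latticeMomentum hL 0]
  ring

/-- `Σ_{v ∈ ℤ/Lℤ} cos⁵(2πv/L) = 0` (`L ≥ 6`; one-coordinate form of `sum_cos_pow_five_latticeMomentum`).
[folklore] -/
theorem sum_cos_pow_five_val (hL : 6 ≤ L) :
    ∑ v : ZMod L, Real.cos (2 * Real.pi * ((v.val : ℝ)) / L) ^ 5 = 0 := by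
  refine sum_val_eq_of_sum_latticeMomentum (fun x => Real.cos x ^ 5) ?_
  rw [sum_cos_pow_five_latticeMomentum hL 0]
  ring

/-- `Σ_{v ∈ ℤ/Lℤ} cos⁶(2πv/L) = 5L/16` (`L ≥ 7`; one-coordinate form of `sum_cos_pow_six_latticeMomentum`).
[folklore] -/
theorem sum_cos_pow_six_val (hL : 7 ≤ L) :
    ∑ v : ZMod L, Real.cos (2 * Real.pi * ((v.val : ℝ)) / L) ^ 6 = 5 * (L : ℝ) / 16 := by
  refine sum_val_eq_of_sum_latticeMomentum (fun x => Real.cos x ^ 6) ?_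
  rw [sum_cos_pow_six_latticeMomentum hL 0]
  ring

/-- `Σ_{v ∈ ℤ/Lℤ} cos⁷(2πv/L) = 0` (`L ≥ 8`; one-coordinate form of `sum_cos_pow_seven_latticeMomentum`).
[folklore] -/
theorem sum_cos_pow_seven_val (hL : 8 ≤ L) :
    ∑ v : ZMod L, Real.cos (2 * Real.pi * ((v.val : ℝ)) / L) ^ 7 = 0 := by
  refine sum_val_eq_of_sum_latticeMomentum (fun x => Real.cos x ^ 7) ?_
  rw [sum_cos_pow_seven_latticeMomentum hL 0]
  ring

/-! ### Band moments of degree 5 to 8 -/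

/-- **`Σ_k ε_L(k)⁵ = 0`** on the `L × L` torus, `L ≥ 6`: every monomial `c₀ⁱ c₁ʲ` of `(c₀ + c₁)⁵` carries an odd
exponent, and odd one-coordinate cosine power sums vanish. [folklore] -/
theorem sum_torusBand_pow_five (hL : 6 ≤ L) : ∑ k : TorusSite 2 L, torusBand L k ^ 5 = 0 := by
  have e : ∀ k : TorusSite 2 L, torusBand L k ^ 5 =
      -32 * Real.cos (latticeMomentum L k 0) ^ 5 + -32 * Real.cos (latticeMomentum L k 1) ^ 5 +
        -160 * (Real.cos (latticeMomentum L k 0) ^ 4 * Real.cos (latticeMomentum L k 1)) +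
        -160 * (Real.cos (latticeMomentum L k 0) * Real.cos (latticeMomentum L k 1) ^ 4) +
        -320 * (Real.cos (latticeMomentum L k 0) ^ 3 * Real.cos (latticeMomentum L k 1) ^ 2) +
        -320 * (Real.cos (latticeMomentum L k 0) ^ 2 * Real.cos (latticeMomentum L k 1) ^ 3) := fun k => by
    unfold torusBand; rw [Fin.sum_univ_two]; ring
  simp_rw [e]
  rw [Finset.sum_add_distrib, Finset.sum_add_distrib, Finset.sum_add_distrib, Finset.sum_add_distrib,
    Finset.sum_add_distrib, ← Finset.mul_sum, ← Finset.mul_sum, ← Finset.mul_sum, ← Finset.mul_sum,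
    ← Finset.mul_sum, ← Finset.mul_sum, sum_cos_pow_five_latticeMomentum hL 0, sum_cos_pow_five_latticeMomentum hL 1,
    sum_mul_latticeMomentum_factor (fun x => Real.cos x ^ 4) (fun x => Real.cos x),
    sum_mul_latticeMomentum_factor (fun x => Real.cos x) (fun x => Real.cos x ^ 4),
    sum_mul_latticeMomentum_factor (fun x => Real.cos x ^ 3) (fun x => Real.cos x ^ 2),
    sum_mul_latticeMomentum_factor (fun x => Real.cos x ^ 2) (fun x => Real.cos x ^ 3),
    sum_cos_val_eq_zero (by omega), sum_cos_pow_three_val (by omega)]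
  ring

/-- **`Σ_k ε_L(k)⁶ = 400 L²`** on the `L × L` torus, `L ≥ 7`: `ε⁶ = 64(c₀ + c₁)⁶`, `Σ cᵢ⁶ = 5L²/16`,
`Σ c₀⁴c₁² = Σ c₀²c₁⁴ = (3L/8)(L/2)`, odd mixed monomials vanish; `64(2·5/16 + 2·15·3/16) = 400 = C(6,3)²`.
(Equivalently `tr T⁶ = 400 L²`: closed 6-step walks on `ℤ²`.) [folklore] -/
theorem sum_torusBand_pow_six (hL : 7 ≤ L) :
    ∑ k : TorusSite 2 L, torusBand L k ^ 6 = 400 * (L : ℝ) ^ 2 := by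
  have e : ∀ k : TorusSite 2 L, torusBand L k ^ 6 =
      64 * Real.cos (latticeMomentum L k 0) ^ 6 + 64 * Real.cos (latticeMomentum L k 1) ^ 6 +
        384 * (Real.cos (latticeMomentum L k 0) ^ 5 * Real.cos (latticeMomentum L k 1)) +
        384 * (Real.cos (latticeMomentum L k 0) * Real.cos (latticeMomentum L k 1) ^ 5) +
        960 * (Real.cos (latticeMomentum L k 0) ^ 4 * Real.cos (latticeMomentum L k 1) ^ 2) +
        960 * (Real.cos (latticeMomentum L k 0) ^ 2 * Real.cos (latticeMomentum L k 1) ^ 4) +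
        1280 * (Real.cos (latticeMomentum L k 0) ^ 3 * Real.cos (latticeMomentum L k 1) ^ 3) := fun k => by
    unfold torusBand; rw [Fin.sum_univ_two]; ring
  simp_rw [e]
  rw [Finset.sum_add_distrib, Finset.sum_add_distrib, Finset.sum_add_distrib, Finset.sum_add_distrib,
    Finset.sum_add_distrib, Finset.sum_add_distrib, ← Finset.mul_sum, ← Finset.mul_sum, ← Finset.mul_sum,
    ← Finset.mul_sum, ← Finset.mul_sum, ← Finset.mul_sum, ← Finset.mul_sum,
    sum_cos_pow_six_latticeMomentum hL 0, sum_cos_pow_six_latticeMomentum hL 1,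
    sum_mul_latticeMomentum_factor (fun x => Real.cos x ^ 5) (fun x => Real.cos x),
    sum_mul_latticeMomentum_factor (fun x => Real.cos x) (fun x => Real.cos x ^ 5),
    sum_mul_latticeMomentum_factor (fun x => Real.cos x ^ 4) (fun x => Real.cos x ^ 2),
    sum_mul_latticeMomentum_factor (fun x => Real.cos x ^ 2) (fun x => Real.cos x ^ 4),
    sum_mul_latticeMomentum_factor (fun x => Real.cos x ^ 3) (fun x => Real.cos x ^ 3),
    sum_cos_val_eq_zero (by omega), sum_cos_pow_three_val (by omega), sum_cos_sq_val (by omega),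
    sum_cos_pow_four_val (by omega)]
  ring

/-- **`Σ_k ε_L(k)⁷ = 0`** on the `L × L` torus, `L ≥ 8`: every monomial of `(c₀ + c₁)⁷` carries an odd exponent.
[folklore] -/
theorem sum_torusBand_pow_seven (hL : 8 ≤ L) : ∑ k : TorusSite 2 L, torusBand L k ^ 7 = 0 := by
  have e : ∀ k : TorusSite 2 L, torusBand L k ^ 7 =
      -128 * Real.cos (latticeMomentum L k 0) ^ 7 + -128 * Real.cos (latticeMomentum L k 1) ^ 7 +
        -896 * (Real.cos (latticeMomentum L k 0) ^ 6 * Real.cos (latticeMomentum L k 1)) +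
        -896 * (Real.cos (latticeMomentum L k 0) * Real.cos (latticeMomentum L k 1) ^ 6) +
        -2688 * (Real.cos (latticeMomentum L k 0) ^ 5 * Real.cos (latticeMomentum L k 1) ^ 2) +
        -2688 * (Real.cos (latticeMomentum L k 0) ^ 2 * Real.cos (latticeMomentum L k 1) ^ 5) +
        -4480 * (Real.cos (latticeMomentum L k 0) ^ 4 * Real.cos (latticeMomentum L k 1) ^ 3) +
        -4480 * (Real.cos (latticeMomentum L k 0) ^ 3 * Real.cos (latticeMomentum L k 1) ^ 4) := fun k => by
    unfold torusBand; rw [Fin.sum_univ_two]; ring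
  simp_rw [e]
  rw [Finset.sum_add_distrib, Finset.sum_add_distrib, Finset.sum_add_distrib, Finset.sum_add_distrib,
    Finset.sum_add_distrib, Finset.sum_add_distrib, Finset.sum_add_distrib, ← Finset.mul_sum, ← Finset.mul_sum,
    ← Finset.mul_sum, ← Finset.mul_sum, ← Finset.mul_sum, ← Finset.mul_sum, ← Finset.mul_sum, ← Finset.mul_sum,
    sum_cos_pow_seven_latticeMomentum hL 0, sum_cos_pow_seven_latticeMomentum hL 1,
    sum_mul_latticeMomentum_factor (fun x => Real.cos x ^ 6) (fun x => Real.cos x),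
    sum_mul_latticeMomentum_factor (fun x => Real.cos x) (fun x => Real.cos x ^ 6),
    sum_mul_latticeMomentum_factor (fun x => Real.cos x ^ 5) (fun x => Real.cos x ^ 2),
    sum_mul_latticeMomentum_factor (fun x => Real.cos x ^ 2) (fun x => Real.cos x ^ 5),
    sum_mul_latticeMomentum_factor (fun x => Real.cos x ^ 4) (fun x => Real.cos x ^ 3),
    sum_mul_latticeMomentum_factor (fun x => Real.cos x ^ 3) (fun x => Real.cos x ^ 4),
    sum_cos_val_eq_zero (by omega), sum_cos_pow_three_val (by omega), sum_cos_pow_five_val (by omega)]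
  ring

/-- **`Σ_k ε_L(k)⁸ = 4900 L²`** on the `L × L` torus, `L ≥ 9`: `ε⁸ = 256(c₀ + c₁)⁸`, `Σ cᵢ⁸ = 35L²/128`,
`Σ c₀⁶c₁² = (5L/16)(L/2)`, `Σ c₀⁴c₁⁴ = (3L/8)²`, odd mixed monomials vanish;
`256(2·35/128 + 2·28·5/32 + 70·9/64) = 4900 = C(8,4)²`. (Equivalently `tr T⁸ = 4900 L²`: closed 8-step walks
on `ℤ²`.) [folklore] -/
theorem sum_torusBand_pow_eight (hL : 9 ≤ L) :
    ∑ k : TorusSite 2 L, torusBand L k ^ 8 = 4900 * (L : ℝ) ^ 2 := by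
  have e : ∀ k : TorusSite 2 L, torusBand L k ^ 8 =
      256 * Real.cos (latticeMomentum L k 0) ^ 8 + 256 * Real.cos (latticeMomentum L k 1) ^ 8 +
        2048 * (Real.cos (latticeMomentum L k 0) ^ 7 * Real.cos (latticeMomentum L k 1)) +
        2048 * (Real.cos (latticeMomentum L k 0) * Real.cos (latticeMomentum L k 1) ^ 7) +
        7168 * (Real.cos (latticeMomentum L k 0) ^ 6 * Real.cos (latticeMomentum L k 1) ^ 2) +
        7168 * (Real.cos (latticeMomentum L k 0) ^ 2 * Real.cos (latticeMomentum L k 1) ^ 6) +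
        14336 * (Real.cos (latticeMomentum L k 0) ^ 5 * Real.cos (latticeMomentum L k 1) ^ 3) +
        14336 * (Real.cos (latticeMomentum L k 0) ^ 3 * Real.cos (latticeMomentum L k 1) ^ 5) +
        17920 * (Real.cos (latticeMomentum L k 0) ^ 4 * Real.cos (latticeMomentum L k 1) ^ 4) := fun k => by
    unfold torusBand; rw [Fin.sum_univ_two]; ring
  simp_rw [e]
  rw [Finset.sum_add_distrib, Finset.sum_add_distrib, Finset.sum_add_distrib, Finset.sum_add_distrib,
    Finset.sum_add_distrib, Finset.sum_add_distrib, Finset.sum_add_distrib, Finset.sum_add_distrib,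
    ← Finset.mul_sum, ← Finset.mul_sum, ← Finset.mul_sum, ← Finset.mul_sum, ← Finset.mul_sum, ← Finset.mul_sum,
    ← Finset.mul_sum, ← Finset.mul_sum, ← Finset.mul_sum,
    sum_cos_pow_eight_latticeMomentum hL 0, sum_cos_pow_eight_latticeMomentum hL 1,
    sum_mul_latticeMomentum_factor (fun x => Real.cos x ^ 7) (fun x => Real.cos x),
    sum_mul_latticeMomentum_factor (fun x => Real.cos x) (fun x => Real.cos x ^ 7),
    sum_mul_latticeMomentum_factor (fun x => Real.cos x ^ 6) (fun x => Real.cos x ^ 2),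
    sum_mul_latticeMomentum_factor (fun x => Real.cos x ^ 2) (fun x => Real.cos x ^ 6),
    sum_mul_latticeMomentum_factor (fun x => Real.cos x ^ 5) (fun x => Real.cos x ^ 3),
    sum_mul_latticeMomentum_factor (fun x => Real.cos x ^ 3) (fun x => Real.cos x ^ 5),
    sum_mul_latticeMomentum_factor (fun x => Real.cos x ^ 4) (fun x => Real.cos x ^ 4),
    sum_cos_val_eq_zero (by omega), sum_cos_pow_three_val (by omega), sum_cos_sq_val (by omega),
    sum_cos_pow_four_val (by omega), sum_cos_pow_six_val (by omega)]
  ring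

/-! ### Hinge sums through octic majorants -/

/-- **Octic majorants of the hinge.** If `max(μ - e, 0) ≤ p₀ + p₁e + ⋯ + p₈e⁸` on `[-4, 4]`, then
`Σ_k (μ - ε_L(k))₊ ≤ L²(p₀ + 4p₂ + 36p₄ + 400p₆ + 4900p₈)` (`L ≥ 9`; band moments
`0, 4L², 0, 36L², 0, 400L², 0, 4900L²`). [folklore] -/
theorem sum_posPart_le_of_octic (hL : 9 ≤ L) {μ p₀ p₁ p₂ p₃ p₄ p₅ p₆ p₇ p₈ : ℝ}
    (hP : ∀ e : ℝ, -4 ≤ e → e ≤ 4 → max (μ - e) 0 ≤ p₀ + p₁ * e + p₂ * e ^ 2 + p₃ * e ^ 3 + p₄ * e ^ 4 +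
      p₅ * e ^ 5 + p₆ * e ^ 6 + p₇ * e ^ 7 + p₈ * e ^ 8) :
    ∑ k : TorusSite 2 L, max (μ - torusBand L k) 0 ≤
      (L : ℝ) ^ 2 * (p₀ + 4 * p₂ + 36 * p₄ + 400 * p₆ + 4900 * p₈) := by
  have hcard : (Finset.univ : Finset (TorusSite 2 L)).card = L ^ 2 := by
    simp [Finset.card_univ, Fintype.card_pi, ZMod.card]
  calc ∑ k : TorusSite 2 L, max (μ - torusBand L k) 0
      ≤ ∑ k : TorusSite 2 L, (p₀ + p₁ * torusBand L k + p₂ * torusBand L k ^ 2 + p₃ * torusBand L k ^ 3 +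
          p₄ * torusBand L k ^ 4 + p₅ * torusBand L k ^ 5 + p₆ * torusBand L k ^ 6 + p₇ * torusBand L k ^ 7 +
          p₈ * torusBand L k ^ 8) :=
        Finset.sum_le_sum fun k _ => hP _ (neg_four_le_torusBand L k) (torusBand_le_four L k)
    _ = (L : ℝ) ^ 2 * p₀ + p₁ * (∑ k : TorusSite 2 L, torusBand L k) +
          p₂ * (∑ k : TorusSite 2 L, torusBand L k ^ 2) + p₃ * (∑ k : TorusSite 2 L, torusBand L k ^ 3) +
          p₄ * (∑ k : TorusSite 2 L, torusBand L k ^ 4) + p₅ * (∑ k : TorusSite 2 L, torusBand L k ^ 5) +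
          p₆ * (∑ k : TorusSite 2 L, torusBand L k ^ 6) + p₇ * (∑ k : TorusSite 2 L, torusBand L k ^ 7) +
          p₈ * (∑ k : TorusSite 2 L, torusBand L k ^ 8) := by
        rw [Finset.sum_add_distrib, Finset.sum_add_distrib, Finset.sum_add_distrib, Finset.sum_add_distrib,
          Finset.sum_add_distrib, Finset.sum_add_distrib, Finset.sum_add_distrib, Finset.sum_add_distrib,
          ← Finset.mul_sum, ← Finset.mul_sum, ← Finset.mul_sum, ← Finset.mul_sum, ← Finset.mul_sum,
          ← Finset.mul_sum, ← Finset.mul_sum, ← Finset.mul_sum, Finset.sum_const, hcard, nsmul_eq_mul]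
        push_cast
        ring
    _ = (L : ℝ) ^ 2 * (p₀ + 4 * p₂ + 36 * p₄ + 400 * p₆ + 4900 * p₈) := by
        rw [sum_torusBand_eq_zero (by omega), sum_torusBand_sq (by omega), sum_torusBand_pow_three (by omega),
          sum_torusBand_pow_four (by omega), sum_torusBand_pow_five (by omega), sum_torusBand_pow_six (by omega),
          sum_torusBand_pow_seven (by omega), sum_torusBand_pow_eight hL]
        ring

/-! ### The Stoner ceiling with an octic hinge majorant -/

/-- **Octic-majorant form of the Stoner criterion** (the shape used by the box evaluation at `U ≤ 6`): for
`U ≥ 0`, `L ≥ 9`, a ground state `ψ` of the `(2n, S^z = 0)` sector of `hubbardTorus 2 L 1 U` with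
`S² ψ = S(S+1) ψ`, `S ≤ n`, any duplicate-free list `l` of `n` momenta, and an octic `P ≥ (μ - ·)₊` on `[-4, 4]`:
`2μ n - L²(p₀ + 4p₂ + 36p₄ + 400p₆ + 4900p₈) - 2Σ_{k∈l} ε_L(k) - U n²/L² ≤ (μ + 4)(n - S)`
(`hinge_spin_le_of_pairedSea_exact` with `sum_posPart_le_of_octic`). Stoner (1938); Tasaki (1998) §5. [folklore] -/
theorem octic_spin_le_of_pairedSea_exact (hL : 9 ≤ L) {U : ℝ} (hU : 0 ≤ U) {n S : ℕ} (hS : S ≤ n)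
    {ψ : Fock (Orb (FermionTorus 2 L))} (hgs : IsGroundStateInSector (hubbardTorus 2 L 1 U) (2 * n) 0 ψ)
    (hspin : spinSq *ᵥ ψ = (((S : ℝ) * ((S : ℝ) + 1) : ℝ) : ℂ) • ψ)
    {l : List (TorusSite 2 L)} (hl : l.Nodup) (hlen : l.length = n) {μ p₀ p₁ p₂ p₃ p₄ p₅ p₆ p₇ p₈ : ℝ}
    (hP : ∀ e : ℝ, -4 ≤ e → e ≤ 4 → max (μ - e) 0 ≤ p₀ + p₁ * e + p₂ * e ^ 2 + p₃ * e ^ 3 + p₄ * e ^ 4 +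
      p₅ * e ^ 5 + p₆ * e ^ 6 + p₇ * e ^ 7 + p₈ * e ^ 8) :
    2 * μ * n - (L : ℝ) ^ 2 * (p₀ + 4 * p₂ + 36 * p₄ + 400 * p₆ + 4900 * p₈) - 2 * ∑ k ∈ l.toFinset, torusBand L k -
        U * ((n : ℝ) ^ 2 / (L : ℝ) ^ 2) ≤ (μ + 4) * ((n : ℝ) - S) :=
  hinge_spin_le_of_pairedSea_exact (le_trans (by norm_num) hL) hU hS hgs hspin hl hlen
    (sum_posPart_le_of_octic hL hP)

end Octic

/-- Registered sub-goal form (item stmt-HubbardSuperconductivity-7331, line `redirect_birth`, lead c11, wave 4):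
the eighth band moment `Σ_k ε_L(k)⁸ = 4900 L²` for `L ≥ 9`. [folklore] -/
theorem sumTorusBandPowEight : ∀ {L : ℕ} [NeZero L], 9 ≤ L →
    ∑ k : TorusSite 2 L, torusBand L k ^ 8 = 4900 * (L : ℝ) ^ 2 :=
  fun hL => sum_torusBand_pow_eight hL

end Summit.HubbardSuperconductivity.HubbardSuperconductivity.Theorems.MesoscopicPairOrder.Negative
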